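import Summits.ResolutionOfSingularities.ResolutionOfSingularities.Theses.Valuative

/-!
# The log final-form trichotomy (crux `Valuative.LuAlphaPTorsor`, line `pfaff-line-log-final-forms`)

Stub `stub_finalFormExits` of the lead's skeleton
`Cruxes/LuAlphaPTorsor/Lines/pfaff-line-log-final-forms.lean` (item
`stmt-ResolutionOfSingularities-0641`), PROVED.

Setting: `R` the local ring of a model at the centre of the valuation (a local domain of
characteristic `p`), `u : Fin d → R` generators of `𝔪`, a boundary `E ⊆ Fin d`, exponents `M`,
`u^M := ∏_{i ∈ E} u_i ^ M_i`. The *log content* of `a ∈ R` is the ideal generated by the values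
`δ a` of all `ℤ`-derivations `δ` of `R` that are logarithmic along the boundary
(`δ u_i ∈ (u_i)` for `i ∈ E`). If the log content of `a` is EXACTLY `(u^M)` and
`a ≡ c^p mod u^M`, then one of three final forms holds: `a` is a `p`-th power; or
`a - c^p = g^p · b` with `g ≠ 0` and `δ b` a unit for some derivation `δ` (monogenic exit,
Stacks 07PG datum); or `a - c'^p = u'^{M'} · B` for a (possibly new) system of generators `u'` of
`𝔪` of the same length, a unit `B` and some exponent prime to `p` (toroidal exit).

Proof (elementary): write `a - c^p = B · u^M`. Log derivations
form an `R`-submodule, so `u^M = δ a` for ONE log derivation `δ`; derivations kill `p`-th powers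
and `δ(u^M) = s · u^M` with `s = ∑_{i∈E} M_i e_i` (`δ u_i = e_i u_i`), whence, cancelling
`u^M ≠ 0` (if `u^M = 0` then `a = c^p`), `s B + δ B = 1`. If `p ∣ M_i` for all `i ∈ E` then
`s = 0`, `δ B = 1` and `u^M = g^p`: monogenic. Otherwise some `p ∤ M_{i₀}`; if `B` is a unit this
is the toroidal form on `u` itself; if `B ∈ 𝔪` then `δ B = 1 - s B` is a unit, so writing
`B = ∑ β_i u_i` some `β_j` with `j ∉ E` is a unit (else `δ B ∈ 𝔪`), and exchanging `u_j` for `B`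
gives new generators `u'` of `𝔪` with `a - c^p = (∏_{i∈E} u_i^{M_i}) · B^1 · 1`.

The `ℤ`-algebra structure on `R` is a hypothesis of the abstract lemmas (not the default
`Ring.toIntAlgebra`) because the registered signature elaborates `Derivation ℤ (Localization …)`
with the localization's own `ℤ`-algebra instance. Regularity of the local ring and `A.FG` are
not used: only that `R` is a local domain with `p = 0`.

Log: (1) direct elementary proof (span induction for one log derivation, cancellation of `u^M`,
generator exchange `u_j ↦ B`); no cotangent-space or Matsumura §14 input was needed.
-/

-- single-problem summit: the doubled namespace component `ResolutionOfSingularities` is forced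
set_option linter.dupNamespace false

namespace Summit.ResolutionOfSingularities.ResolutionOfSingularities.Theorems.PfaffLine

open IsLocalRing

/-- **Logarithmic derivative of a monomial.** If `δ u_i = e_i u_i` for `i ∈ E`, then
`δ (∏_{i∈E} u_i^{M_i}) = (∑_{i∈E} M_i e_i) · ∏_{i∈E} u_i^{M_i}`. [folklore] -/
theorem derivation_prod_pow_eq_sum_mul {R : Type*} [CommRing R] [Algebra ℤ R]
    (δ : Derivation ℤ R R) {ι : Type*} [DecidableEq ι] (E : Finset ι) (u : ι → R) (M : ι → ℕ)
    (e : ι → R) (he : ∀ i ∈ E, δ (u i) = e i * u i) :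
    δ (E.prod fun i => u i ^ M i) =
      (E.sum fun i => (M i : R) * e i) * E.prod fun i => u i ^ M i := by
  induction E using Finset.induction_on with
  | empty => simp
  | insert j E hj ih =>
    have hE : ∀ i ∈ E, δ (u i) = e i * u i := fun i hi => he i (Finset.mem_insert_of_mem hi)
    rw [Finset.prod_insert hj, Finset.sum_insert hj, Derivation.leibniz, Derivation.leibniz_pow,
      ih hE, he j (Finset.mem_insert_self j E), smul_eq_mul, smul_eq_mul, nsmul_eq_mul]
    rcases Nat.eq_zero_or_pos (M j) with h0 | hpos
    · rw [h0]
      ring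
    · obtain ⟨n, hn⟩ := Nat.exists_eq_add_one_of_ne_zero hpos.ne'
      rw [hn, Nat.add_sub_cancel]
      push_cast
      ring

/-- **The log final-form trichotomy, abstract form.** In a local domain `R` with `p = 0`
(`p` prime), let `u : Fin d → R` generate `𝔪`, `E ⊆ Fin d`, `M : Fin d → ℕ`, and suppose the
log content of `a` (values at `a` of the `ℤ`-derivations logarithmic along `{u_i}_{i∈E}`) is
exactly `(∏_{i∈E} u_i^{M_i})` and `a - c^p ∈ (∏_{i∈E} u_i^{M_i})`. Then `a` is a `p`-th power, or
`a - c'^p = g^p b` with `g ≠ 0` and `δ b` a unit for some derivation `δ`, or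
`a - c'^p = (∏_i u'_i^{M'_i}) B` for generators `u' : Fin d → R` of `𝔪`, a unit `B` and some
`p ∤ M'_i`. (The hypothesis `hdim` is only threaded through to the conclusion.) [folklore] -/
theorem finalFormExits_of_span_eq {R : Type*} [CommRing R] [Algebra ℤ R] [IsLocalRing R]
    [IsDomain R] {p : ℕ} (hp : p.Prime) (hpR : (p : R) = 0) (a c : R) {d : ℕ} (u : Fin d → R)
    (E : Finset (Fin d)) (M : Fin d → ℕ)
    (hspan : Ideal.span (Set.range u) = maximalIdeal R)
    (hdim : ringKrullDim R = (d : WithBot ℕ∞))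
    (hcontent : Ideal.span {b | ∃ δ : Derivation ℤ R R,
        (∀ i ∈ E, δ (u i) ∈ Ideal.span {u i}) ∧ δ (a) = b} =
      Ideal.span {E.prod fun i => u i ^ M i})
    (hc : a - c ^ p ∈ Ideal.span {E.prod fun i => u i ^ M i}) :
    ((∃ c : R, a = c ^ p) ∨ ∃ (c g b : R) (δ : Derivation ℤ R R),
        g ≠ 0 ∧ a - c ^ p = g ^ p * b ∧ IsUnit (δ b)) ∨
      (∃ (c : R) (d : ℕ) (u : Fin d → R) (M : Fin d → ℕ) (B : R),
        Ideal.span (Set.range u) = maximalIdeal R ∧ ringKrullDim R = (d : WithBot ℕ∞) ∧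
          IsUnit B ∧ (∃ i, ¬ p ∣ M i) ∧ a - c ^ p = (Finset.univ.prod fun i => u i ^ M i) * B) := by
  classical
  set m : R := E.prod fun i => u i ^ M i with hm_def
  -- `a - c^p = B · u^M`
  obtain ⟨B, hB⟩ := Ideal.mem_span_singleton'.mp hc
  by_cases hm0 : m = 0
  · -- degenerate: `u^M = 0`, so `a = c^p`
    refine Or.inl (Or.inl ⟨c, ?_⟩)
    rw [hm0, mul_zero] at hB
    exact sub_eq_zero.mp hB.symm
  -- one log derivation `δ` with `δ a = u^M` (log derivations form an `R`-submodule)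
  have hmem : m ∈ Ideal.span {b | ∃ δ : Derivation ℤ R R,
      (∀ i ∈ E, δ (u i) ∈ Ideal.span {u i}) ∧ δ a = b} := by
    rw [hcontent]
    exact Ideal.mem_span_singleton_self m
  obtain ⟨δ, hδE, hδa⟩ : ∃ δ : Derivation ℤ R R,
      (∀ i ∈ E, δ (u i) ∈ Ideal.span {u i}) ∧ δ a = m := by
    refine Submodule.span_induction (p := fun b _ => ∃ δ : Derivation ℤ R R,
      (∀ i ∈ E, δ (u i) ∈ Ideal.span {u i}) ∧ δ a = b) (fun b hb => hb)
      ⟨0, fun i _ => by simp, by simp⟩ ?_ ?_ hmem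
    · rintro x y - - ⟨δ₁, h₁, rfl⟩ ⟨δ₂, h₂, rfl⟩
      exact ⟨δ₁ + δ₂, fun i hi => by
        rw [Derivation.add_apply]; exact Ideal.add_mem _ (h₁ i hi) (h₂ i hi), rfl⟩
    · rintro r x - ⟨δ₁, h₁, rfl⟩
      exact ⟨r • δ₁, fun i hi => by
        rw [Derivation.smul_apply, smul_eq_mul]; exact Ideal.mul_mem_left _ _ (h₁ i hi), rfl⟩
  -- log coefficients `e i` (`δ u_i = e_i u_i` for `i ∈ E`)
  have hex : ∀ i, ∃ e : R, i ∈ E → δ (u i) = e * u i := by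
    intro i
    by_cases hi : i ∈ E
    · obtain ⟨e, he⟩ := Ideal.mem_span_singleton'.mp (hδE i hi)
      exact ⟨e, fun _ => he.symm⟩
    · exact ⟨0, fun h => absurd h hi⟩
  choose e he using hex
  set s : R := E.sum fun i => (M i : R) * e i with hs_def
  have hδm : δ m = s * m := derivation_prod_pow_eq_sum_mul δ E u M e he
  have hδcp : δ (c ^ p) = 0 := by
    rw [Derivation.leibniz_pow, nsmul_eq_mul, hpR, zero_mul]
  -- the key identity `s B + δ B = 1`
  have hkey : s * B + δ B = 1 := by
    have h1 : δ a = δ (B * m) + δ (c ^ p) := by rw [hB, ← map_add, sub_add_cancel]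
    rw [hδa, hδcp, add_zero, Derivation.leibniz, hδm, smul_eq_mul, smul_eq_mul] at h1
    have h2 : m * (s * B + δ B) = m * 1 := by linear_combination -h1
    exact mul_left_cancel₀ hm0 h2
  by_cases hdiv : ∀ i ∈ E, p ∣ M i
  · -- monogenic exit: `s = 0`, `δ B = 1`, `u^M = g^p`
    have hs0 : s = 0 := Finset.sum_eq_zero fun i hi => by
      obtain ⟨q, hq⟩ := hdiv i hi
      rw [hq, Nat.cast_mul, hpR, zero_mul, zero_mul]
    rw [hs0, zero_mul, zero_add] at hkey
    set g : R := E.prod fun i => u i ^ (M i / p) with hg_def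
    have hgp : g ^ p = m := by
      rw [hg_def, ← Finset.prod_pow]
      refine Finset.prod_congr rfl fun i hi => ?_
      rw [← pow_mul, Nat.div_mul_cancel (hdiv i hi)]
    refine Or.inl (Or.inr ⟨c, g, B, δ, fun hg0 => hm0 ?_, ?_, hkey ▸ isUnit_one⟩)
    · rw [← hgp, hg0, zero_pow hp.ne_zero]
    · rw [hgp, ← hB, mul_comm]
  push Not at hdiv
  obtain ⟨i₀, hi₀E, hi₀⟩ := hdiv
  by_cases hBu : IsUnit B
  · -- toroidal exit on `u` itself
    refine Or.inr ⟨c, d, u, fun i => if i ∈ E then M i else 0, B, hspan, hdim, hBu,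
      ⟨i₀, by simpa [hi₀E] using hi₀⟩, ?_⟩
    rw [← hB, mul_comm, ← Finset.prod_subset (Finset.subset_univ E) fun i _ hi => by simp [hi]]
    congr 1
    exact Finset.prod_congr rfl fun i hi => by simp [hi]
  -- toroidal exit after exchanging one generator for `B ∈ 𝔪 ∖ 𝔪²`
  have hBm : B ∈ maximalIdeal R := hBu
  have hδB : IsUnit (δ B) := by
    have : δ B = 1 - s * B := by rw [← hkey]; ring
    rw [this]
    exact isUnit_one_sub_self_of_mem_nonunits _ (Ideal.mul_mem_left _ s hBm)
  have hum : ∀ i, u i ∈ maximalIdeal R := fun i => hspan ▸ Ideal.subset_span ⟨i, rfl⟩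
  obtain ⟨β, hβ⟩ := Ideal.mem_span_range_iff_exists_fun.mp (hspan ▸ hBm :
    B ∈ Ideal.span (Set.range u))
  -- some coefficient off the boundary is a unit
  have hj : ∃ j, j ∉ E ∧ IsUnit (β j) := by
    by_contra hcon
    push Not at hcon
    refine (maximalIdeal.isMaximal R).ne_top (Ideal.eq_top_of_isUnit_mem _ ?_ hδB)
    rw [← hβ, map_sum]
    refine Ideal.sum_mem _ fun i _ => ?_
    rw [Derivation.leibniz, smul_eq_mul, smul_eq_mul]
    refine Ideal.add_mem _ ?_ (Ideal.mul_mem_right _ _ (hum i))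
    by_cases hiE : i ∈ E
    · rw [he i hiE]
      exact Ideal.mul_mem_left _ _ (Ideal.mul_mem_left _ _ (hum i))
    · exact Ideal.mul_mem_right _ _ (hcon i hiE)
  obtain ⟨j, hjE, hβj⟩ := hj
  set u' : Fin d → R := Function.update u j B with hu'_def
  have hu'j : u' j = B := Function.update_self j B u
  have hu'i : ∀ i, i ≠ j → u' i = u i := fun i hi => Function.update_of_ne hi B u
  have hspan' : Ideal.span (Set.range u') = maximalIdeal R := by
    apply le_antisymm
    · rw [Ideal.span_le]
      rintro _ ⟨i, rfl⟩
      by_cases hij : i = j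
      · rw [hij, hu'j]
        exact hBm
      · rw [hu'i i hij]
        exact hum i
    · rw [← hspan, Ideal.span_le]
      rintro _ ⟨i, rfl⟩
      by_cases hij : i = j
      · -- `β_j u_j = B - ∑_{l ≠ j} β_l u_l ∈ (u')`, and `β_j` is a unit
        rw [hij]
        have hsum : β j * u j = B - (Finset.univ.erase j).sum fun l => β l * u l := by
          rw [← hβ, ← Finset.add_sum_erase _ _ (Finset.mem_univ j)]
          ring
        have hmem : β j * u j ∈ Ideal.span (Set.range u') := by
          rw [hsum]
          refine Ideal.sub_mem _ (Ideal.subset_span ⟨j, hu'j⟩) (Ideal.sum_mem _ fun l hl => ?_)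
          rw [← hu'i l (Finset.ne_of_mem_erase hl)]
          exact Ideal.mul_mem_left _ _ (Ideal.subset_span ⟨l, rfl⟩)
        obtain ⟨v, hv⟩ := hβj
        have : u j = (↑v⁻¹ : R) * (β j * u j) := by
          rw [← hv, ← mul_assoc, Units.inv_mul, one_mul]
        rw [SetLike.mem_coe, this]
        exact Ideal.mul_mem_left _ _ hmem
      · rw [SetLike.mem_coe, ← hu'i i hij]
        exact Ideal.subset_span ⟨i, rfl⟩
  set M' : Fin d → ℕ := fun i => if i = j then 1 else if i ∈ E then M i else 0 with hM'_def
  refine Or.inr ⟨c, d, u', M', 1, hspan', hdim, isUnit_one, ⟨j, ?_⟩, ?_⟩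
  · simp [hM'_def, hp.ne_one]
  · rw [mul_one, ← hB, ← Finset.mul_prod_erase Finset.univ (fun i => u' i ^ M' i)
      (Finset.mem_univ j)]
    have hMj : M' j = 1 := by simp [hM'_def]
    rw [hMj, pow_one, hu'j]
    congr 1
    symm
    calc (Finset.univ.erase j).prod (fun i => u' i ^ M' i)
        = (Finset.univ.erase j).prod fun i => u i ^ (if i ∈ E then M i else 0) :=
          Finset.prod_congr rfl fun i hi => by
            have hij : i ≠ j := Finset.ne_of_mem_erase hi
            simp [hM'_def, hij, hu'i i hij]
      _ = E.prod fun i => u i ^ (if i ∈ E then M i else 0) := by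
          have hEsub : E ⊆ Finset.univ.erase j := fun i hi =>
            Finset.mem_erase.mpr ⟨ne_of_mem_of_not_mem hi hjE, Finset.mem_univ _⟩
          exact (Finset.prod_subset hEsub fun i _ hi => by simp [hi]).symm
      _ = m := Finset.prod_congr rfl fun i hi => by simp [hi]

/-- **Stub `stub_finalFormExits`** of line `pfaff-line-log-final-forms` (crux
`Valuative.LuAlphaPTorsor`, `stmt-ResolutionOfSingularities-0641`): the log final-form trichotomy
at the centre of a model `A ⊆ O` that is regular there — with log content of `a` EXACTLY `(u^M)`
and `a ≡ c^p mod u^M`, either `a` is a `p`-th power, or a monogenic exit datum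
(`a - c^p = g^p b`, `g ≠ 0`, `δ b` a unit), or a toroidal exit datum (`a - c^p = u'^{M'} B`, `u'`
generators of `𝔪` of length `dim`, `B` a unit, some `p ∤ M'_i`) exists. Instance of
`finalFormExits_of_span_eq` (the local ring is a localization of a subring of the field `K`, hence
a domain, and has characteristic `p` because `k ⊆ K` does). [folklore] -/
theorem stub_finalFormExits :
    ∀ p : ℕ, p.Prime → ∀ (k K : Type) [Field k] [CharP k p] [Field K] [Algebra k K] (O : ValuationSubring K) (A : Subalgebra k K) (h : A.toSubring ≤ O.toSubring), A.FG → IsRegularLocalRing (Localization.AtPrime (Ideal.comap (Subring.inclusion h) (IsLocalRing.maximalIdeal O))) → ∀ (a c : Localization.AtPrime (Ideal.comap (Subring.inclusion h) (IsLocalRing.maximalIdeal O))) (d : ℕ) (u : Fin d → Localization.AtPrime (Ideal.comap (Subring.inclusion h) (IsLocalRing.maximalIdeal O))) (E : Finset (Fin d)) (M : Fin d → ℕ), Ideal.span (Set.range u) = IsLocalRing.maximalIdeal (Localization.AtPrime (Ideal.comap (Subring.inclusion h) (IsLocalRing.maximalIdeal O))) ∧ ringKrullDim (Localization.AtPrime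 (Ideal.comap (Subring.inclusion h) (IsLocalRing.maximalIdeal O))) = (d : WithBot ℕ∞) → Ideal.span {b | ∃ δ : Derivation ℤ (Localization.AtPrime (Ideal.comap (Subring.inclusion h) (IsLocalRing.maximalIdeal O))) (Localization.AtPrime (Ideal.comap (Subring.inclusion h) (IsLocalRing.maximalIdeal O))), (∀ i ∈ E, δ (u i) ∈ Ideal.span {u i}) ∧ δ (a) = b} = Ideal.span {E.prod fun i => u i ^ M i} → a - c ^ p ∈ Ideal.span {E.prod fun i => u i ^ M i} → ((∃ c : Localization.AtPrime (Ideal.comap (Subring.inclusion h) (IsLocalRing.maximalIdeal O)), a = c ^ p) ∨ ∃ (c g b : Localization.AtPrime (Ideal.comap (Subring.inclusion h) (IsLocalRing.maximalIdeal O))) (δ : Derivation ℤ (Localization.AtPrime (Ideal.comap (Subring.inclusion h) (IsLocalRing.maximalIdeal O))) (Localization.AtPrime (Ideal.comap (Subring.inclusion h) (IsLocalRing.maximalIdeal O)))), g ≠ 0 ∧ a - c ^ p = g ^ p * b ∧ IsUnit (δ b)) ∨ (∃ (c : Localization.AtPrime (Ideal.comap (Subring.inclusion h) (IsLocalRing.maximalIdeal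 O))) (d : ℕ) (u : Fin d → Localization.AtPrime (Ideal.comap (Subring.inclusion h) (IsLocalRing.maximalIdeal O))) (M : Fin d → ℕ) (B : Localization.AtPrime (Ideal.comap (Subring.inclusion h) (IsLocalRing.maximalIdeal O))), Ideal.span (Set.range u) = IsLocalRing.maximalIdeal (Localization.AtPrime (Ideal.comap (Subring.inclusion h) (IsLocalRing.maximalIdeal O))) ∧ ringKrullDim (Localization.AtPrime (Ideal.comap (Subring.inclusion h) (IsLocalRing.maximalIdeal O))) = (d : WithBot ℕ∞) ∧ IsUnit B ∧ (∃ i, ¬ p ∣ M i) ∧ a - c ^ p = (Finset.univ.prod fun i => u i ^ M i) * B) := by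
  intro p hp k K _ _ _ _ O A h _ _ a c d u E M hud hcontent hc
  obtain ⟨hspan, hdim⟩ := hud
  -- characteristic `p` descends `k → K ⊇ A → A_𝔭`
  have hpK : (p : K) = 0 := by
    rw [← map_natCast (algebraMap k K) p, CharP.cast_eq_zero k p, map_zero]
  have hpA : (p : A.toSubring) = 0 := Subtype.ext (by simpa using hpK)
  have hpR : (p : Localization.AtPrime (Ideal.comap (Subring.inclusion h)
      (IsLocalRing.maximalIdeal O))) = 0 := by
    rw [← map_natCast (algebraMap A.toSubring (Localization.AtPrime (Ideal.comap
      (Subring.inclusion h) (IsLocalRing.maximalIdeal O)))) p, hpA, map_zero]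
  exact finalFormExits_of_span_eq hp hpR a c u E M hspan hdim hcontent hc

end Summit.ResolutionOfSingularities.ResolutionOfSingularities.Theorems.PfaffLine
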